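import Mathlib
import Literature.NumberTheory.LFunctions.Zhang2022.Section7dStatements
import Literature.NumberTheory.LFunctions.Zhang2022.Section7bStatements
import HarnessLib

/-!
# Zhang (2022), §7 part (c): interface merge of the `𝔗₁₁(p)` / (7.10) stubs (L2-t5 ↔ L2-t3)

Topic `Literature/NumberTheory/LFunctions/Zhang2022` (Landau–Siegel audit tree; verdict-neutral).
Y. Zhang, arXiv:2211.02515v1 (2022) [Zhang2022LandauSiegel], §7 p. 37 (tex L1964, L1973).

THEOREM-ONLY file (0 new facts): the marked interface stubs `Section7dStatements.Iface.frakT11`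
(`𝔗₁₁(p)`, node `Z22:§7.u029`) and `Section7dStatements.Iface.Eq710` ((7.10), node `Z22:(7.10)`)
of the slice-L2-t5 file agree with the owner's declarations `Section7bStatements.frakT11`,
`Section7bStatements.Eq710` (slice L2-t3): `Iface.frakT11_eq_frakT11` (definitional up to the
argument order and `MeanSquareMajorant.conv = LSeries.convolution`), `Iface.eq710_iff`, and the
deduction node of part (c) re-targeted at the owner's (7.10): `dedProp71c_eq710`. Hence dischargers
of `Skeleton.Ded71` may use either name for `𝔗₁₁(p)` and (7.10).

WHAT THIS IS NOT: any claim about Theorems 1–2 of the manuscript or about Landau–Siegel zeros; no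
node is discharged here (pure bookkeeping between two typed files).

## References

* Y. Zhang, arXiv:2211.02515v1 (2022), §7 p. 37, tex L1964 (definition of `𝔗₁₁`), L1973 ((7.10)).
  [cite: Zhang2022LandauSiegel, §7 p.37]
-/

noncomputable section

namespace Literature.NumberTheory.LFunctions.Zhang2022.Section7dStatements

open Complex

/-- IFACE merge: the L2-t5 stub `Iface.frakT11` is the owner's `Section7bStatements.frakT11`
(argument order `(D a₁ a₂ p)` vs `(D p a₁ a₂)`; `MeanSquareMajorant.conv` vs `kappaConv =
LSeries.convolution`). [cite: Zhang2022LandauSiegel, §7 p.37, tex L1964] -/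
theorem Iface.frakT11_eq_frakT11 (c' : ℝ) (D : ℕ) (a₁ a₂ : ℕ → ℂ) (p : ℕ) :
    Iface.frakT11 c' D a₁ a₂ p = Section7bStatements.frakT11 c' D p a₁ a₂ := by
  have hk : Section7bStatements.kappaConv c' D a₁ =
      MeanSquareMajorant.conv (Skeleton.kappaZ c' D) a₁ := by
    funext m
    simp only [Section7bStatements.kappaConv, LSeries.convolution_def, MeanSquareMajorant.conv]
  simp only [Iface.frakT11, Section7bStatements.frakT11, hk, one_div]

/-- IFACE merge: the L2-t5 stub `Iface.Eq710` is equivalent to the owner's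
`Section7bStatements.Eq710`. [cite: Zhang2022LandauSiegel, §7 (7.10) p.37, tex L1973] -/
theorem Iface.eq710_iff (c' : ℝ) : Iface.Eq710 c' ↔ Section7bStatements.Eq710 c' := by
  unfold Iface.Eq710 Section7bStatements.Eq710
  simp only [Iface.frakT11_eq_frakT11, mul_assoc]

/-- The deduction node of part (c) with the owner's conclusion: `DedProp71c` yields
`Section7bStatements.Eq710`. [cite: Zhang2022LandauSiegel, §7 pp.39–42, tex L2063–L2178] -/
theorem dedProp71c_eq710 (c' : ℝ) (h : DedProp71c c') :
    Eq716 c' → Step7u042 c' → Eq717 c' → Step7u043 c' → Eq718 c' → Eq719 c' → Step7u044 →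
    Step7u045a → Step7u045 c' → Step7u046 c' → Step7u047 c' → Step7u049 c' → Step7u050 c' →
    Step7u052 c' → Eq720 c' → Step7u054 c' → Step7u055 c' → Step7u056 c' → Step7u057 c' →
    Eq721 c' → Step7u058 c' → Step7u059 c' → Step7u060 c' → Section7bStatements.Eq710 c' := by
  intro h1 h2 h3 h4 h5 h6 h7 h8 h9 h10 h11 h12 h13 h14 h15 h16 h17 h18 h19 h20 h21 h22 h23
  exact (Iface.eq710_iff c').mp
    (h h1 h2 h3 h4 h5 h6 h7 h8 h9 h10 h11 h12 h13 h14 h15 h16 h17 h18 h19 h20 h21 h22 h23)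

end Literature.NumberTheory.LFunctions.Zhang2022.Section7dStatements
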